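import Summits.ValiantsHypothesis.ValiantsHypothesis.Theorems.LacunarySymmetroidMatrixDescartesSeparatedLadder

/-!
# `MatrixDescartes` — a CONCRETE infinite family beyond the census table: for every `N ≥ 1` the `2 × 2` pencil
# `∑_{l ≤ N} X^(l(l+1)) • 16^(−l(l+1)(2l+1)) • U_l` has at most `2N` positive zeros

HONEST FRAMING.  Object-search cell `pub-symmetroid`, crux `Theses.LacunarySymmetroid.MatrixDescartes`
(ledger item `stmt-ValiantsHypothesis-18050`, route `LacunarySymmetroid`; seat `val-sym-mdr-p2`, gen 12).  The
crux implies `VP ≠ VNP` by the route's assembly; NOTHING here is progress on it and nothing here is a claim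
about `VP ≠ VNP`, `DoorA26` / `DoorA34` or the cell's registers.

`card_posRoots_example_ladder`: `U_l = diag(1, −1)` (even `l`) / the swap matrix (odd `l`) — indefinite unit
letters whose neighbours do NOT commute — exponents `l(l+1) = 0, 2, 6, 12, 20, …` (not an arithmetic
progression; degree of the determinant `2N(N+1)`), scales `16^(−l(l+1)(2l+1))`.  This is a balanced geometric
ladder (`card_posRoots_le_of_geometricLadder`) with hand-over scales `c_j = 4096^(j+1)`, `ρ = 64`,
`ε = 1/4000`, `η = 1`: `(2+1)²·2!·2·3²·(10ε) = 0.81 < 1`.  Hence `Z₊ ≤ 2N = m(K−1)` for EVERY `N`, against the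
Descartes ceiling `C(N+2, 2) − 1` of the format `(2, N+1)` (e.g. `N = 10`: `20` versus `65`).  A kernel witness
that the letter-separated sector is a non-empty, explicit, infinite format family; nothing more. [folklore]
-/

-- `Summit.ValiantsHypothesis.ValiantsHypothesis.…` repeats a component by the D-0017 layout
-- (single-conjunct summit), which the `dupNamespace` linter flags; the name is mandated.
set_option linter.dupNamespace false

namespace Summit.ValiantsHypothesis.ValiantsHypothesis.Theorems.LacunarySymmetroidMatrixDescartes.Separated

open Polynomial Complex Set Finset
open scoped BigOperators Matrix Real

/-! ## §13 A concrete infinite ladder: `∑ₗ X^(l(l+1)) • 16^(−l(l+1)(2l+1)) • U_l` with non-commuting `2 × 2` letters -/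

section Example

/-- The two non-commuting indefinite unit letters `diag(1, −1)` and the swap matrix, alternating along the ladder.
(Written as a lambda inside the statements below; this lemma records their entries and determinants.)
[folklore] -/
theorem example_letter_facts (l : ℕ) :
    (∀ i j : Fin 2, |(if l % 2 = 0 then !![(1 : ℝ), 0; 0, -1] else !![(0 : ℝ), 1; 1, 0]) i j| ≤ 1) ∧
    |(if l % 2 = 0 then !![(1 : ℝ), 0; 0, -1] else !![(0 : ℝ), 1; 1, 0]).det| = 1 := by
  by_cases h : l % 2 = 0
  · simp only [h, if_true]
    refine ⟨fun i j => ?_, ?_⟩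
    · fin_cases i <;> fin_cases j <;> simp
    · rw [Matrix.det_fin_two_of]; norm_num
  · simp only [h, if_false]
    refine ⟨fun i j => ?_, ?_⟩
    · fin_cases i <;> fin_cases j <;> simp
    · rw [Matrix.det_fin_two_of]; norm_num

/-- **A CONCRETE INFINITE FAMILY BEYOND THE CENSUS TABLE.**  For every `N ≥ 1`, the `2 × 2` real lacunary pencil
with `K = N + 1` letters
`F_N(X) = ∑_{l=0}^{N} X^(l(l+1)) • 16^(−l(l+1)(2l+1)) • U_l`, `U_l = diag(1,−1)` for even `l` and the swap matrix
for odd `l` (indefinite, pairwise NON-commuting neighbours, exponents `0, 2, 6, 12, 20, …` not in arithmetic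
progression, degree `2N(N+1)`), has AT MOST `2N = m(K−1)` distinct positive zeros of `det F_N` — against the
Descartes ceiling `C(N+2, 2) − 1` of the format `(2, N+1)`.  It is the balanced geometric ladder with hand-over
scales `c_j = 4096^(j+1)`, `ρ = 64`, `ε = 1/4000`, `η = 1` (`card_posRoots_le_of_geometricLadder`). [folklore] -/
theorem card_posRoots_example_ladder (N : ℕ) (hN : 0 < N) :
    ((Matrix.det (∑ l : Fin (N + 1), ((X : ℝ[X]) ^ (l.val * (l.val + 1))) •
        ((((16 : ℝ)⁻¹) ^ (l.val * (l.val + 1) * (2 * l.val + 1))) •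
          (if l.val % 2 = 0 then !![(1 : ℝ), 0; 0, -1] else !![(0 : ℝ), 1; 1, 0])).map C)).roots.toFinset.filter
        (fun t => 0 < t)).card ≤ N * 2 := by
  set d : Fin (N + 1) → ℕ := fun l => l.val * (l.val + 1) with hd_def
  set σ : Fin (N + 1) → ℝ := fun l => ((16 : ℝ)⁻¹) ^ (l.val * (l.val + 1) * (2 * l.val + 1)) with hσ_def
  set S : Fin (N + 1) → Matrix (Fin 2) (Fin 2) ℝ := fun l =>
    σ l • (if l.val % 2 = 0 then !![(1 : ℝ), 0; 0, -1] else !![(0 : ℝ), 1; 1, 0]) with hS_def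
  have hσpos : ∀ l, 0 < σ l := fun l => by rw [hσ_def]; positivity
  have hd : StrictMono d := by
    intro l l' h
    rw [hd_def]; simp only
    have : l.val < l'.val := h
    nlinarith
  have hgoal := card_posRoots_le_of_geometricLadder (m := 2) d S σ hN hd ?_ hσpos (η := 1) (ε := 1 / 4000) ?_
    (by norm_num) (by norm_num) (by norm_num [Nat.factorial]) (fun j => (4096 : ℝ) ^ (j.val + 1)) (fun _ => 64)
    (fun j => by positivity) (fun _ => by norm_num) ?_ ?_ ?_
  · exact hgoal
  · -- entry bounds
    intro l i j
    rw [hS_def]; simp only [Matrix.smul_apply, smul_eq_mul]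
    rw [abs_mul, abs_of_pos (hσpos l)]
    have := (example_letter_facts l.val).1 i j
    have h0 := (hσpos l).le
    nlinarith
  · -- conditioning `η = 1`
    intro l
    rw [hS_def]; simp only
    rw [Matrix.det_smul, Fintype.card_fin, abs_mul, abs_pow, abs_of_pos (hσpos l), (example_letter_facts l.val).2]
    simp
  · -- balance at `c_j = 4096^(j+1) = 16^(3(j+1))`: both sides equal `16^(j(j+1)(j+2))`
    intro j
    rw [hσ_def, hd_def]; simp only [Fin.val_succ, Fin.val_castSucc]
    have aux : ∀ a t k : ℕ, a + k = 3 * (j.val + 1) * t →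
        ((16 : ℝ)⁻¹) ^ a * ((4096 : ℝ) ^ (j.val + 1)) ^ t = 16 ^ k := by
      intro a t k h
      have h16 : (4096 : ℝ) = 16 ^ 3 := by norm_num
      rw [h16, ← pow_mul, ← pow_mul, show 3 * ((j.val + 1) * t) = a + k by rw [← mul_assoc]; exact h.symm,
        pow_add, inv_pow, ← mul_assoc, inv_mul_cancel₀ (pow_ne_zero _ (by norm_num : (16 : ℝ) ≠ 0)), one_mul]
    rw [aux _ _ (j.val * (j.val + 1) * (j.val + 2)) (by ring), aux _ _ (j.val * (j.val + 1) * (j.val + 2)) (by ring)]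
  · -- hand-over factor: `64^(−(2j+2)) ≤ 1/4000`
    intro j
    rw [hd_def]; simp only [Fin.val_succ, Fin.val_castSucc]
    have hgap : (j.val + 1) * (j.val + 1 + 1) - j.val * (j.val + 1) = 2 * j.val + 2 := by
      apply Nat.sub_eq_of_eq_add; ring
    rw [hgap]
    calc ((64 : ℝ)⁻¹) ^ (2 * j.val + 2) ≤ ((64 : ℝ)⁻¹) ^ 2 :=
          pow_le_pow_of_le_one (by norm_num) (by norm_num) (by omega)
      _ ≤ 1 / 4000 := by norm_num
  · -- separation `4096^(j+1)·64 ≤ 4096^(j+2)/64`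
    intro j j' hjj'
    simp only [hjj']
    rw [le_div_iff₀ (by norm_num : (0 : ℝ) < 64)]
    have e : (4096 : ℝ) ^ (j.val + 1 + 1) = 4096 ^ (j.val + 1) * 64 * 64 := by rw [pow_succ]; ring
    rw [e]

end Example

end Summit.ValiantsHypothesis.ValiantsHypothesis.Theorems.LacunarySymmetroidMatrixDescartes.Separated
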